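import Summits.Ventures.QEC.Census.CertCheckBZBridge
import HarnessLib

/-!
# Systematic generator matrices: the weight of a codeword splits over the information set
# (word lemmas for the in-kernel MITM replay of Brouwer–Zimmermann matrices, census/search-9)

Pure word lemmas in the vocabulary of the CSS distance-certificate checker (`popc`, `xorList`, `maskOf`,
`systematicOK` of `Census/CertBits.lean`, `Census/CertCheckBZ.lean`; `suppIdx` of `Census/CertScan.lean`),
named by qec-search-9 (2026-08-26T23:57:48Z, lemmas L3 and L4 of the soundness proof of the meet-in-the-middle
replay of the `bz_aut` matrices of the `[[144,12,12]]` certificate; writer qec-type-01, co-listed qec-type-11):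

* `testBit_xorList_getD_infoCol` — for `G` systematic on the column list `T` (`systematicOK n G T`: row `j` of
  `G` has bit `T[j']` set iff `j = j'`) and a duplicate-free index list `J ⊆ [0,|G|)`, the codeword
  `c_J := ⊕_{j∈J} G[j]` has bit `T[j']` set iff `j' ∈ J`;
* `getD_injOn_of_systematicOK` — the information-set columns `T[j]`, `j < |T|`, are pairwise distinct;
* `popc_eq_length_add_popc_and_red` (L3, the SYSTEMATIC WEIGHT IDENTITY) —
  `popc n c_J = |J| + popc n (c_J &&& ((2^n − 1) ^^^ maskOf T))`: the weight of `c_J` is its information weight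
  `|J|` plus its weight on the redundancy columns (the complement of `T` below `n`);
* `length_le_popc_xorList_getD`, `popc_and_red_le_of_popc_le` — the two inequalities the replay uses
  (`|J| ≤ popc n c_J`; `popc n c_J ≤ w ⇒` redundancy weight `≤ w − |J|`);
* `pairwise_lt_suppIdx` (L4) — the support index list of a vector is strictly increasing.

All statements are over `ℕ`/`List ℕ` words; proofs are bit extensionality (`Nat.testBit_xor`, `testBit_maskOf`) and
a cardinality split of the bit set `bitSet n c_J` along the information columns. No definitions, no distance value
asserted; tier KERNEL (axioms standard).
-/

namespace Summit.Ventures.QEC.Census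

open Finset

/-! ## Unpacking `systematicOK` -/

section Systematic

variable {n : ℕ} {G T : List ℕ}

/-- `systematicOK n G T` gives `|G| = |T|`. -/
theorem length_eq_of_systematicOK (h : systematicOK n G T = true) : G.length = T.length := by
  simp only [systematicOK, Bool.and_eq_true, beq_iff_eq] at h
  exact h.1.1

/-- `systematicOK n G T` gives: every information-set column is `< n`. -/
theorem lt_of_mem_of_systematicOK (h : systematicOK n G T = true) {q : ℕ} (hq : q ∈ T) : q < n := by
  simp only [systematicOK, Bool.and_eq_true, List.all_eq_true, decide_eq_true_eq] at h
  exact h.1.2 q hq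

/-- `systematicOK n G T` gives: row `j` of `G` has bit `T[j']` set iff `j = j'` (`j, j' < |T|`). -/
theorem testBit_getD_of_systematicOK (h : systematicOK n G T = true) {j j' : ℕ} (hj : j < T.length)
    (hj' : j' < T.length) : (G.getD j 0).testBit (T.getD j' 0) = decide (j = j') := by
  simp only [systematicOK, Bool.and_eq_true, List.all_eq_true, List.mem_range, beq_iff_eq] at h
  exact h.2 j hj j' hj'

/-- In range, `T.getD j 0` is the `j`-th entry, hence a member of `T`. -/
theorem getD_mem_of_lt (T : List ℕ) {j : ℕ} (hj : j < T.length) : T.getD j 0 ∈ T := by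
  rw [List.getD_eq_getElem?_getD, List.getElem?_eq_getElem hj, Option.getD_some]
  exact List.getElem_mem hj

/-- **The information-set columns are distinct**: for `G` systematic on `T`, `T[j] = T[j']` with `j, j' < |T|`
forces `j = j'` (row `j` has bit `T[j]` set, and bit `T[j']` set only if `j = j'`). -/
theorem getD_injOn_of_systematicOK (h : systematicOK n G T = true) {j j' : ℕ} (hj : j < T.length)
    (hj' : j' < T.length) (he : T.getD j 0 = T.getD j' 0) : j = j' := by
  by_contra hne
  have h1 := testBit_getD_of_systematicOK h hj hj
  have h2 := testBit_getD_of_systematicOK h hj hj'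
  rw [← he, h1] at h2
  simp [hne] at h2

/-- **Bits of a codeword on the information set.** For `G` systematic on `T` and a duplicate-free index list
`J ⊆ [0,|G|)`, the XOR of the rows `G[j]`, `j ∈ J`, has bit `T[j']` set iff `j' ∈ J` (`j' < |T|`). -/
theorem testBit_xorList_getD_infoCol (h : systematicOK n G T = true) (J : List ℕ) (hJ : J.Nodup)
    (hJlt : ∀ j ∈ J, j < G.length) {j' : ℕ} (hj' : j' < T.length) :
    (xorList (J.map fun j => G.getD j 0)).testBit (T.getD j' 0) = decide (j' ∈ J) := by
  induction J with
  | nil => simp [xorList]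
  | cons x J ih =>
    rw [List.nodup_cons] at hJ
    have hx : x < T.length := by
      rw [← length_eq_of_systematicOK h]; exact hJlt x List.mem_cons_self
    rw [List.map_cons, xorList, Nat.testBit_xor, ih hJ.2 fun j hj => hJlt j (List.mem_cons_of_mem _ hj),
      testBit_getD_of_systematicOK h hx hj']
    by_cases hxj : x = j'
    · subst hxj
      simp [hJ.1]
    · have hjx : ¬ j' = x := fun e => hxj e.symm
      simp [hxj, hjx]

/-- **The systematic weight identity** (hypothesis-minimal form of L3). For `G` systematic on `T` and a
duplicate-free index list `J ⊆ [0,|G|)`, the weight (below `n`) of the codeword `c_J = ⊕_{j∈J} G[j]` is its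
information weight `|J|` plus its weight on the redundancy columns:
`popc n c_J = |J| + popc n (c_J &&& ((2^n − 1) ^^^ maskOf T))`
(`(2^n − 1) ^^^ maskOf T` is the complement of the information set below `n`; all `T[j] < n`). -/
theorem popc_xorList_getD_eq_length_add (n : ℕ) (G T : List ℕ) (hsys : systematicOK n G T = true)
    (J : List ℕ) (hJ : J.Nodup) (hJlt : ∀ j ∈ J, j < G.length) :
    popc n (xorList (J.map fun j => G.getD j 0)) =
      J.length + popc n (xorList (J.map fun j => G.getD j 0) &&& ((2 ^ n - 1) ^^^ maskOf T)) := by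
  have hlen := length_eq_of_systematicOK hsys
  have hA : ∀ j', j' < T.length →
      (xorList (J.map fun j => G.getD j 0)).testBit (T.getD j' 0) = decide (j' ∈ J) :=
    fun j' hj' => testBit_xorList_getD_infoCol hsys J hJ hJlt hj'
  generalize hc : xorList (J.map fun j => G.getD j 0) = c at hA ⊢
  rw [← card_bitSet, ← card_bitSet,
    ← Finset.card_filter_add_card_filter_not (s := bitSet n c) (fun i : Fin n => (i : ℕ) ∈ T)]
  congr 1
  · -- the information part: exactly the columns `T[j]`, `j ∈ J`
    have himg : ((bitSet n c).filter fun i : Fin n => (i : ℕ) ∈ T).map ⟨Fin.val, Fin.val_injective⟩ =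
        (J.map fun j => T.getD j 0).toFinset := by
      ext q
      simp only [Finset.mem_map, Finset.mem_filter, mem_bitSet, Function.Embedding.coeFn_mk,
        List.mem_toFinset, List.mem_map]
      constructor
      · rintro ⟨i, ⟨hci, hiT⟩, rfl⟩
        obtain ⟨j', hj', hTj'⟩ := List.getElem_of_mem hiT
        have hget : T.getD j' 0 = (i : ℕ) := by
          rw [List.getD_eq_getElem?_getD, List.getElem?_eq_getElem hj', Option.getD_some, hTj']
        refine ⟨j', ?_, hget⟩
        have := hA j' hj'
        rw [hget, hci] at this
        simpa using this
      · rintro ⟨j, hj, rfl⟩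
        have hjT : j < T.length := hlen ▸ hJlt j hj
        have hq : T.getD j 0 ∈ T := getD_mem_of_lt T hjT
        refine ⟨⟨T.getD j 0, lt_of_mem_of_systematicOK hsys hq⟩, ⟨?_, hq⟩, rfl⟩
        have := hA j hjT
        simpa [hj] using this
    rw [← Finset.card_map ⟨Fin.val, Fin.val_injective⟩, himg, List.toFinset_card_of_nodup, List.length_map]
    exact hJ.map_on fun x hx y hy hxy =>
      getD_injOn_of_systematicOK hsys (hlen ▸ hJlt x hx) (hlen ▸ hJlt y hy) hxy
  · -- the redundancy part: the bits of `c` off the information set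
    congr 1
    ext i
    simp only [Finset.mem_filter, mem_bitSet, Nat.testBit_and, Nat.testBit_xor,
      Nat.testBit_two_pow_sub_one, testBit_maskOf, i.isLt, decide_true, Bool.and_eq_true]
    by_cases hiT : (i : ℕ) ∈ T <;> simp [hiT]

/-- **L3 — the systematic weight identity, in the signature requested for the MITM soundness file**
(qec-search-9 2026-08-26T23:57:48Z): as `popc_xorList_getD_eq_length_add`, with the extra hypothesis that the
rows of `G` are words below `2^n` (not needed for the identity; kept, underscore-named, so the lemma applies
verbatim where it was requested). -/
theorem popc_eq_length_add_popc_and_red (n : ℕ) (G T : List ℕ) (hsys : systematicOK n G T = true)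
    (_hG : ∀ g ∈ G, g < 2 ^ n) (J : List ℕ) (hJ : J.Nodup) (hJlt : ∀ j ∈ J, j < G.length) :
    popc n (xorList (J.map fun j => G.getD j 0)) =
      J.length + popc n (xorList (J.map fun j => G.getD j 0) &&& ((2 ^ n - 1) ^^^ maskOf T)) :=
  popc_xorList_getD_eq_length_add n G T hsys J hJ hJlt

/-- Corollary: the information weight bounds the weight from below, `|J| ≤ popc n c_J`. -/
theorem length_le_popc_xorList_getD (n : ℕ) (G T : List ℕ) (hsys : systematicOK n G T = true)
    (J : List ℕ) (hJ : J.Nodup) (hJlt : ∀ j ∈ J, j < G.length) :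
    J.length ≤ popc n (xorList (J.map fun j => G.getD j 0)) := by
  rw [popc_xorList_getD_eq_length_add n G T hsys J hJ hJlt]
  exact Nat.le_add_right _ _

/-- Corollary: a codeword of weight `≤ w` has information weight `|J| ≤ w` and redundancy weight `≤ w − |J|`
(`popc n (c_J &&& ((2^n − 1) ^^^ maskOf T)) ≤ w − |J|`). -/
theorem popc_and_red_le_of_popc_le (n : ℕ) (G T : List ℕ) (hsys : systematicOK n G T = true)
    (J : List ℕ) (hJ : J.Nodup) (hJlt : ∀ j ∈ J, j < G.length) {w : ℕ}
    (hw : popc n (xorList (J.map fun j => G.getD j 0)) ≤ w) :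
    J.length ≤ w ∧
      popc n (xorList (J.map fun j => G.getD j 0) &&& ((2 ^ n - 1) ^^^ maskOf T)) ≤ w - J.length := by
  have h := popc_xorList_getD_eq_length_add n G T hsys J hJ hJlt
  omega

end Systematic

/-! ## L4: support index lists are increasing -/

/-- **L4.** The support index list `suppIdx n w` (the positions `j < n` with `w j ≠ 0`, in increasing order) is
strictly increasing — in particular duplicate-free and sorted, so it is a canonical name of the support. -/
theorem pairwise_lt_suppIdx (n : ℕ) (w : Fin n → ZMod 2) : (suppIdx n w).Pairwise (· < ·) := by
  unfold suppIdx
  exact List.pairwise_map.2 (((List.pairwise_lt_finRange n).filter _).imp fun h => h)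

end Summit.Ventures.QEC.Census
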